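import Summits.CriticalPhenomena.PercolationContinuityZ3.Theorems.PercNearOneGluingNoHeavyLowerTailGCPort
import HarnessLib

/-!
# Goodness of an observer with two pendant-star children, via the port lemma

Crux `PercNearOneGluingNoHeavy.NoHeavyLowerTail` (stmt-CriticalPhenomena-4575); lemma factory #7 (conditional association), helper file.

prim-hp-2's series step `KNGoodSeries.knGood_series_of_gluing` reduces Kozma–Nitzan goodness of `(G, A, o, b)` — `o ∉ A` joined
only to two vertices `x, y` — to goodness of `x` and `y` in `G − o` plus the gluing kernel GC.  With the port lemma
`GCPort.gc_of_twoPort_port` the kernel is discharged when `x, y` are PENDANT STARS (joined, besides `o`, only to relays) and the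
loneliest relay `a₀` of `G − o` is a port of `x`, `x` having at most one further port: `(G, A, o, b)` is GOOD
(`GCPort.knGood_twoPendantStars_of_port`).  Goodness of the children is Kozma–Nitzan's Theorem 4.  The relay graph `G − o − x − y`
is arbitrary; this is goodness (not only Conjecture 1, cf. prim-hp-2's `knConj1_twoPendantStars`) for the minimal configurations
(α), (β) of the two-lonely-children kernel of LEAD-GEN7 §3 whenever the loneliest relay is a port of the two-port child.
-/

noncomputable section

namespace Summit.CriticalPhenomena.PercolationContinuityZ3.Theorems

open MeasureTheory Set Literature.Probability.LatticeModels Literature.Probability.Percolation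
open scoped Classical BigOperators

variable {n : ℕ}

namespace GCPort

open KNGoodAux KNGoodHair RelayNbhd KNGoodSeries

/-- Off `o`, the graph `G − o = pinW w {pairs at o} ∅` has the weights of `G`. [folklore] -/
theorem pinW_star_apply_of_ne (w : Sym2 (Fin n) → unitInterval) {o u v : Fin n} (hu : u ≠ o) (hv : v ≠ o) :
    pinW w {e : Sym2 (Fin n) | o ∈ e ∧ ¬ e.IsDiag} ∅ s(u, v) = w s(u, v) :=
  pinW_apply_of_not_mem w ∅ fun h => by
    rcases Sym2.mem_iff.1 h.1 with h' | h'
    · exact hu h'.symm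
    · exact hv h'.symm

/-- **Goodness of an observer with two pendant-star children when the loneliest relay is a port of the two-port child.**
`o ∉ A` has positive weight only towards `x, y ∉ A`; `x` has positive weight only towards `o` and the relays `a₀, p`; `y` has
positive weight only towards `o` and relays; `a₀` minimises `P_{G−o}(· ↔ b)` over `A`; `b ≠ o, x`.  Then `(G, A, o, b)` is good in
the sense of Kozma–Nitzan.  (Series step of prim-hp-2 + the port lemma + Kozma–Nitzan Theorem 4 for the children.)
[cite: KozmaNitzan2024, §3.2 Definition (p. 12), Thm. 4 (p. 12), Thm. 5 (p. 13), Lemma 3(ii) (pp. 6–7)] -/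
theorem knGood_twoPendantStars_of_port (w : Sym2 (Fin n) → unitInterval) (A : Finset (Fin n)) (hA : A.Nonempty)
    (o x y a₀ p b : Fin n) (ho : o ∉ A) (hxA : x ∉ A) (hyA : y ∉ A) (hxo : x ≠ o) (hyo : y ≠ o) (hxy : x ≠ y)
    (ha₀ : a₀ ∈ A) (hp : p ∈ A) (hpa : p ≠ a₀) (hbo : b ≠ o) (hbx : b ≠ x)
    (hiso : ∀ v : Fin n, v ≠ o → v ≠ x → v ≠ y → (w s(o, v) : ℝ) = 0)
    (hxpairs : ∀ v : Fin n, v ≠ a₀ → v ≠ p → v ≠ x → v ≠ o → w s(x, v) = 0)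
    (hypairs : ∀ v : Fin n, v ∉ A → v ≠ y → v ≠ o → w s(y, v) = 0)
    (hmin : ∀ a' ∈ A, (prodBernoulli (pinW w {e : Sym2 (Fin n) | o ∈ e ∧ ¬ e.IsDiag} ∅)).real (openConn a₀ b) ≤
      (prodBernoulli (pinW w {e : Sym2 (Fin n) | o ∈ e ∧ ¬ e.IsDiag} ∅)).real (openConn a' b)) :
    KNGood w A hA o b := by
  set H : Sym2 (Fin n) → unitInterval := pinW w {e : Sym2 (Fin n) | o ∈ e ∧ ¬ e.IsDiag} ∅ with hH
  have hxa : x ≠ a₀ := fun h => hxA (h ▸ ha₀)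
  have hxp : x ≠ p := fun h => hxA (h ▸ hp)
  -- the pairs of `x` and `y` in `G − o`
  have hHx : ∀ v : Fin n, v ≠ a₀ → v ≠ p → v ≠ x → H s(x, v) = 0 := by
    intro v hva hvp hvx
    by_cases hvo : v = o
    · subst hvo; rw [hH, Sym2.eq_swap]; exact pinW_star_mk w hxo
    · rw [hH, pinW_star_apply_of_ne w hxo hvo]; exact hxpairs v hva hvp hvx hvo
  have hHy : ∀ v : Fin n, v ∉ A → v ≠ y → H s(y, v) = 0 := by
    intro v hvA hvy
    by_cases hvo : v = o
    · subst hvo; rw [hH, Sym2.eq_swap]; exact pinW_star_mk w hyo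
    · rw [hH, pinW_star_apply_of_ne w hyo hvo]; exact hypairs v hvA hvy hvo
  -- the children are good (Kozma–Nitzan Theorem 4: pendant stars)
  have hgoodx : KNGood H A hA x b :=
    KozmaNitzan2024_thm4_good H A hA x b hxA fun u hux huA =>
      hHx u (fun h => huA (h ▸ ha₀)) (fun h => huA (h ▸ hp)) hux
  have hgoody : KNGood H A hA y b :=
    KozmaNitzan2024_thm4_good H A hA y b hyA fun u huy huA => hHy u huA huy
  -- the gluing kernel: the port lemma
  have hGC := gc_of_twoPort_port H A hA x y a₀ p b hxA hyA hxy ha₀ hp hpa hbx hHx hHy hmin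
  exact knGood_series_of_gluing w A hA o x y a₀ b ho hxo hyo hxy ha₀ hbo hiso hmin hgoodx hgoody hGC

end GCPort

end Summit.CriticalPhenomena.PercolationContinuityZ3.Theorems
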